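import Summits.AtomisticToContinuum.HydrodynamicLimit.Theorems.JParityClosureRateFloorPairFunctionalVelocityStats
import Literature.MathematicalPhysics.KineticTheory.CollisionTubePairMean
import HarnessLib

/-!
# Line `Sketch` of crux `RateFloor`, rung 0: the doubly truncated mark and the loss of its ideal pair rate
# (helper file, `--supports stmt-AtomisticToContinuum-13080`)

W-side input of `stub_staticOpacityFloorRung0` (c2 lane).  The static tube statistics
(`Literature/…/CollisionTubePairMeanLowerBound`, `CollisionTubeVarianceStaticsSharp`) need a mark vanishing at relative
speed `≥ 2L`, and the sure window comparison (`JParityClosureRateFloorWindowFloorRung0`) a mark vanishing at speed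
`‖v‖ ≥ 2V` of the first particle.  For a continuous mark `0 ≤ Ξ ≤ C` the DOUBLY TRUNCATED mark

  `Ξ_{L,V}(n, v, w) = Ξ(n, v, w) ψ_L(‖w − v‖) ψ_V(‖v‖)`     (`speedCutoff`; written out inline, no new definition)

is continuous, `0 ≤ Ξ_{L,V} ≤ Ξ`, vanishes where required, and its ideal pair rate under two independent Maxwellians
`N(u, θ)` is smaller than that of `Ξ` by at most

  `C |S²| (‖u‖² + 3θ) (4/L + 5/(2V))`     (`integral_sphereMark_le_trunc₂_add`):

the lost mark is `≤ Ξ(1 − ψ_L) + Ξ(1 − ψ_V)`, the first sphere-integrates to `≤ (C|S²|/L) ‖w − v‖²`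
(`sphereMark_tail_le`), the second to `≤ (‖v‖/V) C|S²| ‖w − v‖ ≤ (C|S²|/2V)(‖v‖² + ‖w − v‖²)`, and the Gaussian
second moments are `‖u‖² + 3θ` (`integral_norm_sq_gaussMeasure`, `integral_norm_sub_sq_prod_gauss_le`).
-/

noncomputable section

open MeasureTheory ProbabilityTheory Set Filter Topology Function
open scoped ENNReal BigOperators

namespace Summit.AtomisticToContinuum.HydrodynamicLimit.Theorems

namespace RateFloorCutoffLoss

open Literature.Analysis.FluidPDE Literature.MathematicalPhysics.KineticTheory RateFloorPairFunctionalUpper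

/-! ## The doubly truncated mark -/

/-- The doubly truncated mark is continuous. [folklore] -/
theorem continuous_trunc₂ {Ξ : V3 × V3 × V3 → ℝ} (hΞ : Continuous Ξ) (L V : ℝ) :
    Continuous (fun q : V3 × V3 × V3 => Ξ q * speedCutoff L ‖q.2.2 - q.2.1‖ * speedCutoff V ‖q.2.1‖) := by
  exact (continuous_truncMark hΞ L).mul
    ((show Continuous (speedCutoff V) by unfold speedCutoff; fun_prop).comp (by fun_prop))

/-- `0 ≤ Ξ_{L,V} ≤ Ξ` for `Ξ ≥ 0`. [folklore] -/
theorem trunc₂_nonneg_le {Ξ : V3 × V3 × V3 → ℝ} (hΞ0 : ∀ q, 0 ≤ Ξ q) (L V : ℝ) (q : V3 × V3 × V3) :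
    0 ≤ Ξ q * speedCutoff L ‖q.2.2 - q.2.1‖ * speedCutoff V ‖q.2.1‖ ∧
      Ξ q * speedCutoff L ‖q.2.2 - q.2.1‖ * speedCutoff V ‖q.2.1‖ ≤ Ξ q := by
  obtain ⟨a0, a1⟩ := speedCutoff_mem_Icc L ‖q.2.2 - q.2.1‖
  obtain ⟨b0, b1⟩ := speedCutoff_mem_Icc V ‖q.2.1‖
  refine ⟨mul_nonneg (mul_nonneg (hΞ0 q) a0) b0, ?_⟩
  calc Ξ q * speedCutoff L ‖q.2.2 - q.2.1‖ * speedCutoff V ‖q.2.1‖ ≤ Ξ q * speedCutoff L ‖q.2.2 - q.2.1‖ * 1 :=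
        mul_le_mul_of_nonneg_left b1 (mul_nonneg (hΞ0 q) a0)
    _ = Ξ q * speedCutoff L ‖q.2.2 - q.2.1‖ := mul_one _
    _ ≤ Ξ q * 1 := mul_le_mul_of_nonneg_left a1 (hΞ0 q)
    _ = Ξ q := mul_one _

/-- `|Ξ_{L,V}| ≤ C` for `0 ≤ Ξ ≤ C`. [folklore] -/
theorem abs_trunc₂_le {Ξ : V3 × V3 × V3 → ℝ} (hΞ0 : ∀ q, 0 ≤ Ξ q) {C : ℝ} (hΞC : ∀ q, Ξ q ≤ C) (L V : ℝ)
    (q : V3 × V3 × V3) : |Ξ q * speedCutoff L ‖q.2.2 - q.2.1‖ * speedCutoff V ‖q.2.1‖| ≤ C := by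
  obtain ⟨h0, h1⟩ := trunc₂_nonneg_le hΞ0 L V q
  rw [abs_of_nonneg h0]
  exact h1.trans (hΞC q)

/-- `Ξ_{L,V}` vanishes at relative speed `≥ 2L` (`L > 0`). [folklore] -/
theorem trunc₂_eq_zero_of_speed {Ξ : V3 × V3 × V3 → ℝ} {L : ℝ} (hL : 0 < L) (V : ℝ) (m v v' : V3)
    (h : 2 * L ≤ ‖v - v'‖) :
    Ξ (m, v, v') * speedCutoff L ‖((m, v, v') : V3 × V3 × V3).2.2 - ((m, v, v') : V3 × V3 × V3).2.1‖ *
      speedCutoff V ‖((m, v, v') : V3 × V3 × V3).2.1‖ = 0 := by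
  have h' : 2 * L ≤ ‖v' - v‖ := by rwa [norm_sub_rev]
  simp only [speedCutoff_eq_zero hL h', mul_zero, zero_mul]

/-- `Ξ_{L,V}` vanishes at speed `‖v‖ ≥ 2V` of the first particle (`V > 0`). [folklore] -/
theorem trunc₂_eq_zero_of_norm {Ξ : V3 × V3 × V3 → ℝ} (L : ℝ) {V : ℝ} (hV : 0 < V) (m v v' : V3)
    (h : 2 * V ≤ ‖v‖) :
    Ξ (m, v, v') * speedCutoff L ‖((m, v, v') : V3 × V3 × V3).2.2 - ((m, v, v') : V3 × V3 × V3).2.1‖ *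
      speedCutoff V ‖((m, v, v') : V3 × V3 × V3).2.1‖ = 0 := by
  simp only [speedCutoff_eq_zero hV h, mul_zero]

/-! ## The lost mark -/

/-- `1 − ψ_V(s) ≤ s / V` for `s ≥ 0`, `V > 0`. [folklore] -/
theorem one_sub_speedCutoff_le {V s : ℝ} (hV : 0 < V) (hs : 0 ≤ s) : 1 - speedCutoff V s ≤ s / V := by
  unfold speedCutoff
  have h1 : 1 - s / V ≤ min (2 - s / V) 1 := le_min (by linarith) (by linarith [div_nonneg hs hV.le])
  have h2 : min (2 - s / V) 1 ≤ max (min (2 - s / V) 1) 0 := le_max_left _ _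
  linarith

/-- **The lost mark is at most the sum of the two single-cutoff tails**:
`Ξ − Ξ_{L,V} ≤ Ξ(1 − ψ_L) + Ξ(1 − ψ_V)` (`1 − ab ≤ (1 − a) + (1 − b)` on `[0,1]²`). [folklore] -/
theorem sub_trunc₂_le {Ξ : V3 × V3 × V3 → ℝ} (hΞ0 : ∀ q, 0 ≤ Ξ q) (L V : ℝ) (q : V3 × V3 × V3) :
    Ξ q - Ξ q * speedCutoff L ‖q.2.2 - q.2.1‖ * speedCutoff V ‖q.2.1‖ ≤
      Ξ q * (1 - speedCutoff L ‖q.2.2 - q.2.1‖) + Ξ q * (1 - speedCutoff V ‖q.2.1‖) := by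
  obtain ⟨a0, a1⟩ := speedCutoff_mem_Icc L ‖q.2.2 - q.2.1‖
  obtain ⟨b0, b1⟩ := speedCutoff_mem_Icc V ‖q.2.1‖
  have hab : 1 - speedCutoff L ‖q.2.2 - q.2.1‖ * speedCutoff V ‖q.2.1‖ ≤
      (1 - speedCutoff L ‖q.2.2 - q.2.1‖) + (1 - speedCutoff V ‖q.2.1‖) := by
    nlinarith
  have := mul_le_mul_of_nonneg_left hab (hΞ0 q)
  nlinarith

/-- The tail mark in the speed of the first particle sphere-integrates to `(1 − ψ_V(‖v‖)) Θ Ξ v w`. [folklore] -/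
theorem sphereMark_normTail_eq {Ξ : V3 × V3 × V3 → ℝ} (V : ℝ) (v w : V3) :
    sphereMark (fun q => Ξ q * (1 - speedCutoff V ‖q.2.1‖)) v w = (1 - speedCutoff V ‖v‖) * sphereMark Ξ v w := by
  unfold sphereMark
  rw [← integral_const_mul]
  refine integral_congr_ae (ae_of_all _ fun ω => ?_)
  simp only
  ring

/-- **Pointwise loss bound**: for `0 ≤ Ξ ≤ C` continuous, `L, V > 0`,
`Θ Ξ v w ≤ Θ Ξ_{L,V} v w + (C|S²|/L) ‖w − v‖² + (C|S²|/(2V)) (‖v‖² + ‖w − v‖²)`. [folklore] -/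
theorem sphereMark_le_trunc₂_add {Ξ : V3 × V3 × V3 → ℝ} (hΞ : Continuous Ξ) (hΞ0 : ∀ q, 0 ≤ Ξ q) {C : ℝ}
    (hΞC : ∀ q, Ξ q ≤ C) {L V : ℝ} (hL : 0 < L) (hV : 0 < V) (v w : V3) :
    sphereMark Ξ v w ≤ sphereMark (fun q : V3 × V3 × V3 => Ξ q * speedCutoff L ‖q.2.2 - q.2.1‖ * speedCutoff V ‖q.2.1‖) v w +
      (C * (sphereMeasure : Measure (Metric.sphere (0 : V3) 1)).real univ / L * ‖w - v‖ ^ 2 +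
        C * (sphereMeasure : Measure (Metric.sphere (0 : V3) 1)).real univ / (2 * V) * (‖v‖ ^ 2 + ‖w - v‖ ^ 2)) := by
  haveI := isFiniteMeasure_sphereMeasure (E := V3)
  set S : ℝ := (sphereMeasure : Measure (Metric.sphere (0 : V3) 1)).real univ with hS
  have hS0 : 0 ≤ S := measureReal_nonneg
  have hC0 : 0 ≤ C := (hΞ0 0).trans (hΞC 0)
  -- decomposition `Ξ = Ξ_{L,V} + R`, `R ≤ R_L + R_V`
  set T₂ : V3 × V3 × V3 → ℝ := (fun q : V3 × V3 × V3 => Ξ q * speedCutoff L ‖q.2.2 - q.2.1‖ * speedCutoff V ‖q.2.1‖) with hT₂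
  set R : V3 × V3 × V3 → ℝ := fun q => Ξ q - T₂ q with hR
  set RL : V3 × V3 × V3 → ℝ := fun q => Ξ q * (1 - speedCutoff L ‖q.2.2 - q.2.1‖) with hRL
  set RV : V3 × V3 × V3 → ℝ := fun q => Ξ q * (1 - speedCutoff V ‖q.2.1‖) with hRV
  have hTc : Continuous (fun q : V3 × V3 × V3 => Ξ q * speedCutoff L ‖q.2.2 - q.2.1‖ * speedCutoff V ‖q.2.1‖) := continuous_trunc₂ hΞ L V
  have hRc : Continuous R := hΞ.sub hTc
  have hRLc : Continuous RL := continuous_tailMark hΞ L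
  have hRVc : Continuous RV :=
    hΞ.mul (continuous_const.sub ((show Continuous (speedCutoff V) by unfold speedCutoff; fun_prop).comp (by fun_prop)))
  have hdec : sphereMark Ξ v w = sphereMark T₂ v w + sphereMark R v w := by
    have : Ξ = fun q => T₂ q + R q := by funext q; simp only [hR]; ring
    conv_lhs => rw [this]
    exact sphereMark_add hTc hRc v w
  have hRle : sphereMark R v w ≤ sphereMark RL v w + sphereMark RV v w := by
    rw [← sphereMark_add hRLc hRVc]
    exact sphereMark_mono hRc (hRLc.add hRVc) (fun q => by simp only [hR, hT₂]; exact sub_trunc₂_le hΞ0 L V q) v w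
  -- the two tails
  have h1 : sphereMark RL v w ≤ C * S / L * ‖w - v‖ ^ 2 := sphereMark_tail_le hΞ hΞ0 hΞC hL v w
  have h2 : sphereMark RV v w ≤ C * S / (2 * V) * (‖v‖ ^ 2 + ‖w - v‖ ^ 2) := by
    rw [hRV, sphereMark_normTail_eq]
    have hΘ : sphereMark Ξ v w ≤ C * S * ‖w - v‖ := sphereMark_le_mul_norm hΞ hΞ0 hΞC v w
    have hΘ0 : 0 ≤ sphereMark Ξ v w := sphereMark_nonneg' hΞ0 v w
    have ht : 1 - speedCutoff V ‖v‖ ≤ ‖v‖ / V := one_sub_speedCutoff_le hV (norm_nonneg v)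
    have ht0 : 0 ≤ 1 - speedCutoff V ‖v‖ := by linarith [(speedCutoff_mem_Icc V ‖v‖).2]
    have hamgm : ‖v‖ * ‖w - v‖ ≤ (‖v‖ ^ 2 + ‖w - v‖ ^ 2) / 2 := by nlinarith [sq_nonneg (‖v‖ - ‖w - v‖)]
    calc (1 - speedCutoff V ‖v‖) * sphereMark Ξ v w ≤ ‖v‖ / V * (C * S * ‖w - v‖) :=
          mul_le_mul ht hΘ hΘ0 (div_nonneg (norm_nonneg _) hV.le)
      _ = C * S / V * (‖v‖ * ‖w - v‖) := by field_simp
      _ ≤ C * S / V * ((‖v‖ ^ 2 + ‖w - v‖ ^ 2) / 2) :=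
          mul_le_mul_of_nonneg_left hamgm (div_nonneg (mul_nonneg hC0 hS0) hV.le)
      _ = C * S / (2 * V) * (‖v‖ ^ 2 + ‖w - v‖ ^ 2) := by field_simp
  linarith [hdec, hRle, h1, h2]

/-! ## Integrability of the sphere-integrated mark under two Maxwellians -/

/-- `(v, w) ↦ Θ Ξ v w` is integrable under `N(u,θ) ⊗ N(u,θ)` for a continuous mark `0 ≤ Ξ ≤ C`. [folklore] -/
theorem integrable_sphereMark_prod_gauss {Ξ : V3 × V3 × V3 → ℝ} (hΞ : Continuous Ξ) (hΞ0 : ∀ q, 0 ≤ Ξ q) {C : ℝ}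
    (hΞC : ∀ q, Ξ q ≤ C) (u : V3) (θ : ℝ) :
    Integrable (fun p : V3 × V3 => sphereMark Ξ p.1 p.2) ((gaussMeasure u θ).prod (gaussMeasure u θ)) := by
  haveI := isFiniteMeasure_sphereMeasure (E := V3)
  set S : ℝ := (sphereMeasure : Measure (Metric.sphere (0 : V3) 1)).real univ with hS
  have hS0 : 0 ≤ S := measureReal_nonneg
  have hC0 : 0 ≤ C := (hΞ0 0).trans (hΞC 0)
  have h1 : Integrable (fun p : V3 × V3 => ‖p.1‖ ^ 2) ((gaussMeasure u θ).prod (gaussMeasure u θ)) :=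
    (integrable_norm_sq_gaussMeasure u θ).comp_fst _
  have h2 : Integrable (fun p : V3 × V3 => ‖p.2‖ ^ 2) ((gaussMeasure u θ).prod (gaussMeasure u θ)) :=
    (integrable_norm_sq_gaussMeasure u θ).comp_snd _
  have hdom : Integrable (fun p : V3 × V3 => C * S * (1 + (2 * ‖p.1‖ ^ 2 + 2 * ‖p.2‖ ^ 2)))
      ((gaussMeasure u θ).prod (gaussMeasure u θ)) :=
    ((integrable_const 1).add ((h1.const_mul 2).add (h2.const_mul 2))).const_mul _
  refine Integrable.mono' hdom (measurable_sphereMark hΞ).aestronglyMeasurable (ae_of_all _ fun p => ?_)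
  rw [Real.norm_eq_abs, abs_of_nonneg (sphereMark_nonneg' hΞ0 _ _)]
  have hle := sphereMark_le_mul_norm hΞ hΞ0 hΞC p.1 p.2
  have hn : ‖p.2 - p.1‖ ≤ 1 + (2 * ‖p.1‖ ^ 2 + 2 * ‖p.2‖ ^ 2) := by
    nlinarith [norm_sub_sq_le_two p.1 p.2, norm_nonneg (p.2 - p.1), sq_nonneg (‖p.2 - p.1‖ - 1)]
  exact hle.trans (mul_le_mul_of_nonneg_left hn (mul_nonneg hC0 hS0))

/-! ## The loss of the ideal pair rate -/

/-- **Loss of the ideal pair rate under the double truncation**: for a continuous mark `0 ≤ Ξ ≤ C`, `θ > 0`,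
`L, V > 0`,
`∫ Θ Ξ d(N ⊗ N) ≤ ∫ Θ Ξ_{L,V} d(N ⊗ N) + C |S²| (‖u‖² + 3θ) (4/L + 5/(2V))`. [folklore] -/
theorem integral_sphereMark_le_trunc₂_add (u : V3) {θ : ℝ} (hθ : 0 < θ) {Ξ : V3 × V3 × V3 → ℝ} (hΞ : Continuous Ξ)
    (hΞ0 : ∀ q, 0 ≤ Ξ q) {C : ℝ} (hΞC : ∀ q, Ξ q ≤ C) {L V : ℝ} (hL : 0 < L) (hV : 0 < V) :
    ∫ p, sphereMark Ξ p.1 p.2 ∂((gaussMeasure u θ).prod (gaussMeasure u θ)) ≤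
      (∫ p, sphereMark (fun q : V3 × V3 × V3 => Ξ q * speedCutoff L ‖q.2.2 - q.2.1‖ * speedCutoff V ‖q.2.1‖) p.1 p.2
          ∂((gaussMeasure u θ).prod (gaussMeasure u θ))) +
        C * (sphereMeasure : Measure (Metric.sphere (0 : V3) 1)).real univ * (‖u‖ ^ 2 + 3 * θ) * (4 / L + 5 / (2 * V)) := by
  haveI := isFiniteMeasure_sphereMeasure (E := V3)
  set γ2 := (gaussMeasure u θ).prod (gaussMeasure u θ) with hγ2
  set S : ℝ := (sphereMeasure : Measure (Metric.sphere (0 : V3) 1)).real univ with hS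
  have hS0 : 0 ≤ S := measureReal_nonneg
  have hC0 : 0 ≤ C := (hΞ0 0).trans (hΞC 0)
  -- integrable pieces
  have hIΞ : Integrable (fun p : V3 × V3 => sphereMark Ξ p.1 p.2) γ2 := integrable_sphereMark_prod_gauss hΞ hΞ0 hΞC u θ
  set T₂ : V3 × V3 × V3 → ℝ := (fun q : V3 × V3 × V3 => Ξ q * speedCutoff L ‖q.2.2 - q.2.1‖ * speedCutoff V ‖q.2.1‖) with hT₂
  have hIT : Integrable (fun p : V3 × V3 => sphereMark T₂ p.1 p.2) γ2 :=
    integrable_sphereMark_prod_gauss (continuous_trunc₂ hΞ L V) (fun q => (trunc₂_nonneg_le hΞ0 L V q).1)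
      (fun q => (trunc₂_nonneg_le hΞ0 L V q).2.trans (hΞC q)) u θ
  have h1 : Integrable (fun p : V3 × V3 => ‖p.1‖ ^ 2) γ2 := (integrable_norm_sq_gaussMeasure u θ).comp_fst _
  have hsub : Integrable (fun p : V3 × V3 => ‖p.2 - p.1‖ ^ 2) γ2 := by
    have h2 : Integrable (fun p : V3 × V3 => ‖p.2‖ ^ 2) γ2 := (integrable_norm_sq_gaussMeasure u θ).comp_snd _
    exact Integrable.mono' ((h1.const_mul 2).add (h2.const_mul 2))
      ((continuous_snd.sub continuous_fst).norm.pow 2).aestronglyMeasurable (ae_of_all _ fun p => by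
        rw [Real.norm_eq_abs, abs_of_nonneg (sq_nonneg _)]; exact norm_sub_sq_le_two p.1 p.2)
  have hB1 : Integrable (fun p : V3 × V3 => C * S / L * ‖p.2 - p.1‖ ^ 2) γ2 := hsub.const_mul _
  have h1s : Integrable (fun p : V3 × V3 => ‖p.1‖ ^ 2 + ‖p.2 - p.1‖ ^ 2) γ2 := h1.add hsub
  have hB2 : Integrable (fun p : V3 × V3 => C * S / (2 * V) * (‖p.1‖ ^ 2 + ‖p.2 - p.1‖ ^ 2)) γ2 := h1s.const_mul _
  have hB : Integrable (fun p : V3 × V3 =>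
      C * S / L * ‖p.2 - p.1‖ ^ 2 + C * S / (2 * V) * (‖p.1‖ ^ 2 + ‖p.2 - p.1‖ ^ 2)) γ2 := hB1.add hB2
  -- the moments
  have hm1 : ∫ p : V3 × V3, ‖p.1‖ ^ 2 ∂γ2 = ‖u‖ ^ 2 + 3 * θ := by
    rw [hγ2, integral_fun_fst (fun v : V3 => ‖v‖ ^ 2), probReal_univ, one_smul, integral_norm_sq_gaussMeasure u hθ]
  have hm2 : ∫ p : V3 × V3, ‖p.2 - p.1‖ ^ 2 ∂γ2 ≤ 4 * (‖u‖ ^ 2 + 3 * θ) := integral_norm_sub_sq_prod_gauss_le u hθ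
  have hE0 : 0 ≤ ‖u‖ ^ 2 + 3 * θ := by positivity
  -- integrate the pointwise bound
  calc ∫ p, sphereMark Ξ p.1 p.2 ∂γ2
      ≤ ∫ p, (sphereMark T₂ p.1 p.2 +
          (C * S / L * ‖p.2 - p.1‖ ^ 2 + C * S / (2 * V) * (‖p.1‖ ^ 2 + ‖p.2 - p.1‖ ^ 2))) ∂γ2 :=
        integral_mono hIΞ (hIT.add hB) fun p => sphereMark_le_trunc₂_add hΞ hΞ0 hΞC hL hV p.1 p.2
    _ = (∫ p, sphereMark T₂ p.1 p.2 ∂γ2) +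
          (C * S / L * ∫ p : V3 × V3, ‖p.2 - p.1‖ ^ 2 ∂γ2 +
            C * S / (2 * V) * ((∫ p : V3 × V3, ‖p.1‖ ^ 2 ∂γ2) + ∫ p : V3 × V3, ‖p.2 - p.1‖ ^ 2 ∂γ2)) := by
        rw [integral_add hIT hB, integral_add hB1 hB2, integral_const_mul, integral_const_mul, integral_add h1 hsub]
    _ ≤ (∫ p, sphereMark T₂ p.1 p.2 ∂γ2) +
          (C * S / L * (4 * (‖u‖ ^ 2 + 3 * θ)) + C * S / (2 * V) * ((‖u‖ ^ 2 + 3 * θ) + 4 * (‖u‖ ^ 2 + 3 * θ))) := by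
        rw [hm1]
        have hcL : 0 ≤ C * S / L := div_nonneg (mul_nonneg hC0 hS0) hL.le
        have hcV : 0 ≤ C * S / (2 * V) := div_nonneg (mul_nonneg hC0 hS0) (by linarith)
        gcongr
    _ = (∫ p, sphereMark T₂ p.1 p.2 ∂γ2) + C * S * (‖u‖ ^ 2 + 3 * θ) * (4 / L + 5 / (2 * V)) := by
        field_simp
        ring

/-- Registered stub `stub_cutoffLossRung0` of crux stmt-AtomisticToContinuum-13080 (line `Sketch`, c2 lane): the closed form of
`integral_sphereMark_le_trunc₂_add`. -/
theorem stub_cutoffLossRung0 : ∀ (u : V3) (θ : ℝ), 0 < θ → ∀ (Ξ : V3 × V3 × V3 → ℝ), Continuous Ξ → (∀ q, 0 ≤ Ξ q) → ∀ (C : ℝ), (∀ q, Ξ q ≤ C) → ∀ (L V : ℝ), 0 < L → 0 < V → ∫ p, sphereMark Ξ p.1 p.2 ∂((gaussMeasure u θ).prod (gaussMeasure u θ)) ≤ (∫ p, sphereMark (fun q : V3 × V3 × V3 => Ξ q * speedCutoff L ‖q.2.2 - q.2.1‖ * speedCutoff V ‖q.2.1‖) p.1 p.2 ∂((gaussMeasure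 u θ).prod (gaussMeasure u θ))) + C * (sphereMeasure : Measure (Metric.sphere (0 : V3) 1)).real Set.univ * (‖u‖ ^ 2 + 3 * θ) * (4 / L + 5 / (2 * V)) :=
  fun u _θ hθ _Ξ hΞ hΞ0 _C hΞC _L _V hL hV => integral_sphereMark_le_trunc₂_add u hθ hΞ hΞ0 hΞC hL hV

/-- `0 ≤ 1 − ψ_V(s)`. [folklore] -/
theorem one_sub_speedCutoff_nonneg (V s : ℝ) : 0 ≤ 1 - speedCutoff V s := by linarith [(speedCutoff_mem_Icc V s).2]

end RateFloorCutoffLoss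

end Summit.AtomisticToContinuum.HydrodynamicLimit.Theorems

end
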